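import Mathlib
import HarnessLib
import Summits.RiemannHypothesis.Statement
import Summits.RiemannHypothesis.RiemannHypothesis.Theses.MayerPairing
import Summits.RiemannHypothesis.RiemannHypothesis.Theorems.MayerPairingNontrivialZeroLocus
import Summits.RiemannHypothesis.RiemannHypothesis.Theorems.MayerPairingTarget

/-!
# RiemannHypothesis / MayerPairing — the assembly

Route `RiemannHypothesis/MayerPairing`, item stmt-RiemannHypothesis-1472 (`Assembly`, rank 1):

  `EisensteinEigenvalueOne → UnitCircleCrossedOnce → BranchPairing → RiemannHypothesis`

(all three hypotheses inlined verbatim in the route file, so that `Assembly` unfolds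
definitionally to this implication between the named items).

Proof. The route's deciding theorem `closes : UnitCircleCrossedOnce → BranchPairing →
NontrivialZeroLocus → RH` (in the Theses file) does all the work; the ζ-side bookkeeping
`NontrivialZeroLocus` (every non-trivial zero has `0 < Re s < 1` and `|Im s| > 14`) is proved in
`Theorems/MayerPairingNontrivialZeroLocus.lean`. The dictionary hypothesis
`EisensteinEigenvalueOne` is logically idle, exactly as the route card declares: `BranchPairing`
carries its own endpoint claims.

For the record, the mathematics of `closes`: a zero `s` (non-trivial, `s ≠ 1`) is moved into the
quarter `0 < Re ρ ≤ 1/2`, `Im ρ > 14` by `s ↦ 1 - s` (`riemannZeta_one_sub`) and `ρ ↦ conj ρ`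
(`riemannZeta_conj`); if `Re ρ < 1/2`, `BranchPairing` gives a continuous eigenvalue selection `Λ`
of Mayer's `L_{σ + i Im ρ/2}` on `[Re ρ/2, (1 - Re ρ)/2]` with `Λ = 1` at both endpoints, and
`UnitCircleCrossedOnce` at height `τ = Im ρ/2 ≥ 7` forbids `‖Λ a‖ = ‖Λ b‖ = 1` — contradiction;
hence `Re ρ = 1/2` and `Re s = 1/2`.

References: D. Mayer, Bull. AMS 25 (1991) 55–60, Thm 2; C.-H. Chang and D. Mayer, Contemp. Math.
290 (2001), Prop. 4.1(v); T. Kato, *Perturbation Theory for Linear Operators* (1966), VII §1.3.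

Maintenance record (full-build repair, 2026-08-17; dependency drift, statements unchanged). The route was
CLOSED `retired` on 2026-08-16T08:47Z (kill criterion K1: `UnitCircleCrossedOnce` numerically false) and
the regenerated route file no longer carries the deciding theorem `closes`, so the three proofs below
(`closes hU hB mayerPairing_nontrivialZeroLocus`) stopped elaborating (47:8, 54:2, 60:2). `closes` was
re-homed verbatim (three-binder form, same kernel-checked proof) as
`Summit.RiemannHypothesis.RiemannHypothesis.Theorems.mayerPairing_closes` in
`Theorems/MayerPairingTarget.lean` (full-build repair of 2026-08-16); this module now imports it and the
three proofs call `mayerPairing_closes` instead — nothing else changed.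
-/

-- `Summit.<Summit>.<Problem>` is the mandated summit-side namespace (CONVENTIONS §2); for the
-- single-conjunct summit `RiemannHypothesis` the two coincide, so the duplicate is deliberate.
set_option linter.dupNamespace false

namespace Summit.RiemannHypothesis.RiemannHypothesis.Theorems

open Summit.RiemannHypothesis.RiemannHypothesis.Theses.MayerPairing

/-- **Assembly of route MayerPairing (stmt-RiemannHypothesis-1472).**
`EisensteinEigenvalueOne → UnitCircleCrossedOnce → BranchPairing → RiemannHypothesis`:
the deciding theorem `closes` (re-homed as `mayerPairing_closes` since the route's retirement) fed with
the in-tree zero-locus bookkeeping `mayerPairing_nontrivialZeroLocus`; the dictionary hypothesis is not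
used. [folklore] -/
theorem mayerPairing_assembly :
    Summit.RiemannHypothesis.RiemannHypothesis.Theses.MayerPairing.Assembly := by
  unfold Summit.RiemannHypothesis.RiemannHypothesis.Theses.MayerPairing.Assembly
  intro _ hU hB
  exact mayerPairing_closes hU hB mayerPairing_nontrivialZeroLocus

/-- The assembly with the idle dictionary hypothesis dropped:
`UnitCircleCrossedOnce → BranchPairing → RiemannHypothesis`, unconditionally (the zero-locus
bookkeeping being proved in tree). [folklore] -/
theorem mayerPairing_riemannHypothesis_of_cruxes (hU : UnitCircleCrossedOnce)
    (hB : BranchPairing) : _root_.Summit.RiemannHypothesis :=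
  mayerPairing_closes hU hB mayerPairing_nontrivialZeroLocus

/-- The target `Target = UnitCircleCrossedOnce ∧ BranchPairing` (stmt-RiemannHypothesis-1473)
implies the Riemann Hypothesis unconditionally. [folklore] -/
theorem mayerPairing_riemannHypothesis_of_target' (hT : Target) :
    _root_.Summit.RiemannHypothesis :=
  mayerPairing_closes hT.1 hT.2 mayerPairing_nontrivialZeroLocus

end Summit.RiemannHypothesis.RiemannHypothesis.Theorems
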